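import Summits.HodgeConjecture.HodgeConjecture.Theorems.H413WeilFinRepMirror
import Literature.NumberTheory.GelbartRogawski1991.DoubledUnitaryConj
import Literature.NumberTheory.Weil1964.AdelicMetaplecticRationalLiftConj
import Literature.NumberTheory.Weil1964.AdelicSiegelParabolicLift
import HarnessLib

/-!
# The SCALAR-CONJUGATE (mirror) of the doubled Weil representation — preparations: `Λ δ Λ = m(ρ) δ`, origin values of rational Levi
# lifts, the Siegel bookkeeping along `H_{dW′}(𝔸) = H_{dW}(𝔸)`, and `π′ ∘ sD′ = ι′^𝔻`

Cell `hodgecm-mathlib`, floor 0, programme P5 (`Cruxes/HLiu418/Lines/F0_AlbCm.lean`), crux item `stmt-HodgeConjecture-24832`; K-E3 lane, ROAD U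
step (U1), part 1 of 2 (sequel: `HLiu418DoubledWeilMirror.lean`).  THEOREMS ONLY (no definition, no named fact, no instance, no `sorry`); rank-GENERIC (`N`, `M` arbitrary).

The complex-conjugate twin of ★ `isDoubledWeilRep_relabel_comp_conj` (`DoubledWeilRepresentationRelabel`, Galois conjugation `h ↦ h̄` +
the relabelling `Λ`).  Here the group element does NOT move (`H_{dW′}(𝔸) = H_{dW}(𝔸)` for `realDiagonal dW′ = −realDiagonal dW`, ★ `HA_eq`), the
operator is conjugated by `C : Φ ↦ Φ̄` (★ `adelicMpContConj`: `(g, M) ↦ (g, C M C)`, `Mp_ψ(𝕎_T)ᶜᵒⁿᵗ ≃* Mp_ψ(𝕎_{−T})ᶜᵒⁿᵗ`, [Li1992, p. 181] «`ω*` is `ω_{ψ̄}`»)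
and re-typed along `−T^𝔻(dW) = T^𝔻(dW′)` (★ `mpCongr`, ★ `gramDA_eq_neg`).  The one new point w.r.t. the relabelling route is Weil's rational
element `δ` of the parabolic normalisation: `C` fixes symplectic components, so `(r_T(δ))ᶜ = r_{−T}(Λ δ Λ)` (★ `adelicMpContConj_ratThetaLiftCont`),
and `Λ δ Λ ≠ δ`; but **`Λ δ Λ = m(ρ) · δ`** for the RATIONAL LEVI element `m(ρ)`, `ρ = 1_𝕎 ⊕ (−1_{𝕎⁻})` (§1, a block-matrix identity), whose
Θ-rigid lift `r(m(ρ)) = (m(ρ), Φ ↦ Φ(· ρ))` (★ `coe_ratThetaLiftCont_levi`) preserves values at the origin (§2); so the value-at-the-origin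
scalar of `r′(δ) sD′(p) r′(δ)⁻¹ = r′(m ρ)⁻¹ (r(δ) sD(p) r(δ)⁻¹)ᶜ r′(m ρ)` is the COMPLEX CONJUGATE of that of `r(δ) sD(p) r(δ)⁻¹`, i.e.
`conj (χ(det_Δ p)) |det_Δ p|^{1/2} = χ⁻¹(det_Δ p) |det_Δ p|^{1/2}` for unitary `χ` (§4–§5).

* §1 `negOffDiag_deltaD` — `Λ δ Λ = m(ρ) δ` in `Sp_{2(n+n)}(L⁺)`;
* §2 `coe_ratThetaLiftCont_levi(_inv)_mem_adelicMpZero`, `apply_zero_omega_of_mem_adelicMpZero` — `(ω(r(m γ)^{±1}) Φ)(0) = Φ(0)` for rational `γ`;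
* §3 casts: `mpCongr` on `r_T`, the bookkeeping of `P_Δ`, `det_Δ`, `χ(det_Δ)`, `|det_Δ|` along a matrix-preserving `θ : H_{dW′} →* H_{dW}`;
* §4 `proj_mirror` — `π′ ∘ sD′ = ι′^𝔻`.  (§5, the parabolic scalar and **`isDoubledWeilRep_mirror`**, is the sequel file.)

HC_CM is proved only modulo the 7 printed citations (+ declared floor-0 debt) until rung 0 closes; this file proves nothing about them.

## References
* [GelbartRogawski1991] S. Gelbart, J. Rogawski, Invent. Math. 105 (1991), §3.1 Prop. 3.1.1 p. 455 L1–2, Remark p. 457 L4–13.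
* [Kudla1994] S. Kudla, Israel J. Math. 87 (1994), §2 (doubled space, Siegel parabolic), §3 Thm. 3.1.
* [HarrisKudlaSweet1996] M. Harris, S. Kudla, W. J. Sweet, J. AMS 9 (1996), §1 (1.14)–(1.15).
* [Li1992] J.-S. Li, J. reine angew. Math. 428 (1992), p. 181.  [MoeglinVignerasWaldspurger1987] LNM 1291, Chap. 2 II.1.
* [Weil1964] A. Weil, Acta Math. 111 (1964), Chap. I n° 13 p. 160, Chap. III n° 40–41.
-/

set_option autoImplicit false
set_option linter.dupNamespace false

noncomputable section

open scoped Classical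
open scoped Matrix ComplexConjugate
open NumberField IsDedekindDomain
open Literature.RepresentationTheory.HeisenbergGroup Literature.RepresentationTheory.HeisenbergGroup.SymplecticMatrix
open Literature.NumberTheory.Automorphic
open Literature.NumberTheory.Weil1964
open Literature.NumberTheory.GaloisRepresentations
open Literature.NumberTheory.GelbartRogawski1991 Literature.NumberTheory.GelbartRogawski1991.UnitaryDualPair
open Literature.NumberTheory.GelbartRogawski1991.GRConstruction
open Literature.NumberTheory.Automorphic.UnitaryGroup

namespace Summit.HodgeConjecture.HodgeConjecture.Cruxes.HLiu418.DoubledWeilMirror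

/-! ## §1 `Λ δ Λ = m(ρ) · δ` -/

section Delta

variable (K : Type*) [CommRing K] (n : ℕ)

/-- the reflection `ρ = 1 ⊕ (−1)` of `L⁺^{n+n} = L⁺ⁿ ⊕ L⁺ⁿ` (re-enumerated by `e₂`) is an involution. [cite: Kudla1994, §2] -/
theorem reindex_fromBlocks_one_neg_one_mul_self :
    Matrix.reindex (e₂ (n := n)) (e₂ (n := n)) (Matrix.fromBlocks (1 : Matrix (Fin n) (Fin n) K) 0 0 (-1)) *
        Matrix.reindex (e₂ (n := n)) (e₂ (n := n)) (Matrix.fromBlocks (1 : Matrix (Fin n) (Fin n) K) 0 0 (-1)) = 1 := by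
  rw [Matrix.reindex_apply, Matrix.submatrix_mul_equiv, Matrix.fromBlocks_multiply]
  simp only [Matrix.mul_one, Matrix.mul_zero, add_zero, zero_add, Matrix.mul_neg, neg_neg, neg_zero, Matrix.fromBlocks_one,
    Matrix.submatrix_one_equiv]

/-- … and symmetric. [cite: Kudla1994, §2] -/
theorem transpose_reindex_fromBlocks_one_neg_one :
    (Matrix.reindex (e₂ (n := n)) (e₂ (n := n)) (Matrix.fromBlocks (1 : Matrix (Fin n) (Fin n) K) 0 0 (-1)))ᵀ =
      Matrix.reindex (e₂ (n := n)) (e₂ (n := n)) (Matrix.fromBlocks (1 : Matrix (Fin n) (Fin n) K) 0 0 (-1)) := by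
  rw [Matrix.reindex_apply, Matrix.transpose_submatrix, Matrix.fromBlocks_transpose]
  simp only [Matrix.transpose_one, Matrix.transpose_zero, Matrix.transpose_neg]

/-- **`Λ δ Λ = m(ρ) δ`**: negating the off-diagonal blocks of Weil's rational element `δ = deltaD` (★ `negOffDiag`, the effect of complex conjugation
on Darboux matrices) is LEFT multiplication by the Levi element `m(ρ)` of any `ρ ∈ GL_{n+n}(L⁺)` whose matrix is the reflection `1 ⊕ (−1)`
(`ρ = ρ⁻¹ = ρᵀ`). [cite: Kudla1994, §2] [cite: Weil1964, Chap. III n° 46 p. 202] -/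
theorem negOffDiag_deltaD (L : Type) [Field L] [NumberField L] [IsCMField L] (ρ : GL (Fin (n + n)) (Fp L))
    (hρ : (ρ : Matrix (Fin (n + n)) (Fin (n + n)) (Fp L)) =
      Matrix.reindex (e₂ (n := n)) (e₂ (n := n)) (Matrix.fromBlocks (1 : Matrix (Fin n) (Fin n) (Fp L)) 0 0 (-1))) :
    negOffDiag (deltaD L (n := n)) = levi ρ * deltaD L := by
  apply Subtype.ext
  rw [coe_negOffDiag, Submonoid.coe_mul, coe_levi]
  -- the inverse of the reflection is itself, and it is symmetric
  have hmul : (ρ : Matrix (Fin (n + n)) (Fin (n + n)) (Fp L)) *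
      Matrix.reindex (e₂ (n := n)) (e₂ (n := n)) (Matrix.fromBlocks (1 : Matrix (Fin n) (Fin n) (Fp L)) 0 0 (-1)) = 1 := by
    rw [hρ]
    exact reindex_fromBlocks_one_neg_one_mul_self (Fp L) n
  have hinv : ((ρ⁻¹ : GL (Fin (n + n)) (Fp L)) : Matrix (Fin (n + n)) (Fin (n + n)) (Fp L)) =
      Matrix.reindex (e₂ (n := n)) (e₂ (n := n)) (Matrix.fromBlocks (1 : Matrix (Fin n) (Fin n) (Fp L)) 0 0 (-1)) :=
    Units.inv_eq_of_mul_eq_one_right hmul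
  rw [hinv, hρ, transpose_reindex_fromBlocks_one_neg_one]
  -- both sides as `reindex (e₂ ⊕ e₂)` of a block computation over `(Fin n ⊕ Fin n) ⊕ (Fin n ⊕ Fin n)`
  have hN : (SymplecticMatrix.negUnit : Matrix (Fin (n + n) ⊕ Fin (n + n)) (Fin (n + n) ⊕ Fin (n + n)) (Fp L)) =
      Matrix.reindex ((e₂ (n := n)).sumCongr (e₂ (n := n))) ((e₂ (n := n)).sumCongr (e₂ (n := n)))
        (Matrix.fromBlocks (1 : Matrix (Fin n ⊕ Fin n) (Fin n ⊕ Fin n) (Fp L)) 0 0 (-1)) := by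
    rw [SymplecticMatrix.negUnit, Matrix.reindex_apply]
    ext (i | i) (j | j) <;>
      simp [Matrix.fromBlocks, Matrix.one_apply, (e₂ (n := n)).symm.injective.eq_iff]
  have hM : Matrix.fromBlocks (Matrix.reindex (e₂ (n := n)) (e₂ (n := n)) (Matrix.fromBlocks (1 : Matrix (Fin n) (Fin n) (Fp L)) 0 0 (-1)))
        0 0 (Matrix.reindex (e₂ (n := n)) (e₂ (n := n)) (Matrix.fromBlocks (1 : Matrix (Fin n) (Fin n) (Fp L)) 0 0 (-1))) =
      Matrix.reindex ((e₂ (n := n)).sumCongr (e₂ (n := n))) ((e₂ (n := n)).sumCongr (e₂ (n := n)))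
        (Matrix.fromBlocks (Matrix.fromBlocks (1 : Matrix (Fin n) (Fin n) (Fp L)) 0 0 (-1)) 0 0
          (Matrix.fromBlocks (1 : Matrix (Fin n) (Fin n) (Fp L)) 0 0 (-1))) := by
    rw [Matrix.reindex_apply, Matrix.reindex_apply]
    ext (i | i) (j | j) <;> simp [Matrix.fromBlocks]
  have hδ : ((deltaD L (n := n) : Matrix.symplecticGroup (Fin (n + n)) (Fp L)) : Matrix (Fin (n + n) ⊕ Fin (n + n)) (Fin (n + n) ⊕ Fin (n + n)) (Fp L)) =
      Matrix.reindex ((e₂ (n := n)).sumCongr (e₂ (n := n))) ((e₂ (n := n)).sumCongr (e₂ (n := n))) (deltaDiagMatrix (Fp L) (Fin n)) := rfl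
  rw [hN, hM, hδ, Matrix.reindex_apply, Matrix.reindex_apply, Matrix.reindex_apply, Matrix.submatrix_mul_equiv,
    Matrix.submatrix_mul_equiv, Matrix.submatrix_mul_equiv]
  congr 1
  rw [deltaDiagMatrix, Matrix.fromBlocks_multiply, Matrix.fromBlocks_multiply, Matrix.fromBlocks_multiply]
  simp only [Matrix.mul_one, Matrix.mul_zero, Matrix.zero_mul, Matrix.one_mul, add_zero, zero_add, Matrix.mul_neg, Matrix.neg_mul,
    neg_neg, neg_zero, Matrix.fromBlocks_multiply, Matrix.fromBlocks_neg]

end Delta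

/-! ## §2 Origin values: the Θ-rigid lift of a rational Levi element preserves `Φ(0)` -/

section Origin

variable (F : Type) [Field F] [NumberField F] {k : ℕ} (T : Matrix (Fin k) (Fin k) (AdeleRing (𝓞 F) F)) (hT : IsUnit T.det)

/-- `r(m(γ)) = (m(γ), Φ ↦ Φ(· γ))` fixes `δ₀ : Φ ↦ Φ(0)`. [cite: Weil1964, Chap. I n° 13 p. 160] -/
theorem coe_ratThetaLiftCont_levi_mem_adelicMpZero (γ : GL (Fin k) F) :
    (ratThetaLiftCont F T hT (levi γ) : adelicMp F (Fin k) T) ∈ adelicMpZero F T := by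
  rw [coe_ratThetaLiftCont_levi]
  exact leviPair_mem_adelicMpZero F T hT (ratGL F γ)

/-- … hence so does its inverse. [cite: Weil1964, Chap. I n° 13 p. 160] -/
theorem coe_ratThetaLiftCont_levi_inv_mem_adelicMpZero (γ : GL (Fin k) F) :
    (((ratThetaLiftCont F T hT (levi γ))⁻¹ : adelicMpCont F (Fin k) T) : adelicMp F (Fin k) T) ∈ adelicMpZero F T := by
  rw [Subgroup.coe_inv]
  exact (adelicMpZero F T).inv_mem (coe_ratThetaLiftCont_levi_mem_adelicMpZero F T hT γ)

variable {F T}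

/-- **a `δ₀`-fixing element of the group of record preserves the value at the origin**: `(ω(q) Φ)(0) = Φ(0)`.
[cite: Weil1964, Chap. I n° 13 p. 160] -/
theorem apply_zero_omega_of_mem_adelicMpZero {q : adelicMpCont F (Fin k) T} (hq : (q : adelicMp F (Fin k) T) ∈ adelicMpZero F T)
    (Φ : piSchwartzBruhat F (Fin k)) :
    ((adelicMpCont.omega F (Fin k) T q Φ : piSchwartzBruhat F (Fin k)) : (Fin k → AdeleRing (𝓞 F) F) → ℂ) 0 =
      (Φ : (Fin k → AdeleRing (𝓞 F) F) → ℂ) 0 :=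
  (mem_adelicMpZero_iff _).1 hq Φ

end Origin

/-! ## §3 Casts: `mpCongr` on Weil's rational lift; the Siegel bookkeeping along `H_{dW′}(𝔸) = H_{dW}(𝔸)` -/

section Casts

variable {F : Type} [Field F] [NumberField F] {k : ℕ} {T₁ T₂ : Matrix (Fin k) (Fin k) (AdeleRing (𝓞 F) F)}

/-- `mpCongr` (the identity re-typed along `T₁ = T₂`) carries `r_{T₁}(γ)` to `r_{T₂}(γ)`. [cite: Weil1964, Chap. III n° 40 p. 190] -/
theorem mpCongr_ratThetaLiftCont (h : T₁ = T₂) (h₁ : IsUnit T₁.det) (h₂ : IsUnit T₂.det) (γ : Matrix.symplecticGroup (Fin k) F) :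
    mpCongr h (ratThetaLiftCont F T₁ h₁ γ) = ratThetaLiftCont F T₂ h₂ γ := by
  subst h
  rfl

end Casts

variable (L : Type) [Field L] [NumberField L] [IsCMField L]
variable {N M n : ℕ} (e : Fin N × Fin M ≃ Fin n)
  (dV : Fin N → L) (hdV : ∀ i, IsCMField.complexConj L (dV i) = dV i) (hdV0 : ∀ i, dV i ≠ 0)
  (dW : Fin M → L) (hdW : ∀ i, IsCMField.complexConj L (dW i) = dW i) (hdW0 : ∀ i, dW i ≠ 0)
  (dW' : Fin M → L) (hdW' : ∀ i, IsCMField.complexConj L (dW' i) = dW' i) (hdW0' : ∀ i, dW' i ≠ 0)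

section Siegel

variable {L e dV hdV dW hdW dW' hdW'}
variable {θ : HA L e dV hdV dW' hdW' →* HA L e dV hdV dW hdW}

/-- the block matrix of `θ h` is that of `h` when `θ` does not move matrices. [cite: Kudla1994, §2 (doubled space, Siegel parabolic)] -/
theorem blk_eq_of_coe_eq
    (hθ : ∀ h : HA L e dV hdV dW' hdW',
      (((θ h : HA L e dV hdV dW hdW) : GL (Fin (n + n)) (AdeleRing (𝓞 L) L)) : Matrix (Fin (n + n)) (Fin (n + n)) (AdeleRing (𝓞 L) L)) =
        (((h : HA L e dV hdV dW' hdW') : GL (Fin (n + n)) (AdeleRing (𝓞 L) L)) : Matrix (Fin (n + n)) (Fin (n + n)) (AdeleRing (𝓞 L) L)))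
    (h : HA L e dV hdV dW' hdW') :
    blk L e dV hdV dW hdW (θ h) = blk L e dV hdV dW' hdW' h := by
  rw [blk, blk, hθ]

/-- `det_Δ (θ h) = det_Δ h`. [cite: Kudla1994, §2 (doubled space, Siegel parabolic)] -/
theorem detDelta_eq_of_coe_eq
    (hθ : ∀ h : HA L e dV hdV dW' hdW',
      (((θ h : HA L e dV hdV dW hdW) : GL (Fin (n + n)) (AdeleRing (𝓞 L) L)) : Matrix (Fin (n + n)) (Fin (n + n)) (AdeleRing (𝓞 L) L)) =
        (((h : HA L e dV hdV dW' hdW') : GL (Fin (n + n)) (AdeleRing (𝓞 L) L)) : Matrix (Fin (n + n)) (Fin (n + n)) (AdeleRing (𝓞 L) L)))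
    (h : HA L e dV hdV dW' hdW') :
    detDelta L e dV hdV dW hdW (θ h) = detDelta L e dV hdV dW' hdW' h := by
  rw [detDelta, detDelta, deltaBlock, deltaBlock, blk_eq_of_coe_eq hθ]

/-- `θ h ∈ P_Δ ↔ h ∈ P_Δ`. [cite: Kudla1994, §2 (doubled space, Siegel parabolic)] -/
theorem isSiegelDelta_iff_of_coe_eq
    (hθ : ∀ h : HA L e dV hdV dW' hdW',
      (((θ h : HA L e dV hdV dW hdW) : GL (Fin (n + n)) (AdeleRing (𝓞 L) L)) : Matrix (Fin (n + n)) (Fin (n + n)) (AdeleRing (𝓞 L) L)) =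
        (((h : HA L e dV hdV dW' hdW') : GL (Fin (n + n)) (AdeleRing (𝓞 L) L)) : Matrix (Fin (n + n)) (Fin (n + n)) (AdeleRing (𝓞 L) L)))
    (h : HA L e dV hdV dW' hdW') :
    IsSiegelDelta L e dV hdV dW hdW (θ h) ↔ IsSiegelDelta L e dV hdV dW' hdW' h := by
  unfold IsSiegelDelta
  rw [blk_eq_of_coe_eq hθ]

/-- `χ(det_Δ (θ p)) = χ(det_Δ p)`. [cite: GelbartRogawski1991, §3.1 Prop. 3.1.1 p. 455 L1–2] -/
theorem chiDet_eq_of_coe_eq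
    (hθ : ∀ h : HA L e dV hdV dW' hdW',
      (((θ h : HA L e dV hdV dW hdW) : GL (Fin (n + n)) (AdeleRing (𝓞 L) L)) : Matrix (Fin (n + n)) (Fin (n + n)) (AdeleRing (𝓞 L) L)) =
        (((h : HA L e dV hdV dW' hdW') : GL (Fin (n + n)) (AdeleRing (𝓞 L) L)) : Matrix (Fin (n + n)) (Fin (n + n)) (AdeleRing (𝓞 L) L)))
    (χ : HeckeCharacter L) (p : HA L e dV hdV dW' hdW') :
    chiDet L e dV hdV dW hdW χ (θ p) = chiDet L e dV hdV dW' hdW' χ p := by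
  unfold chiDet
  by_cases hu : IsUnit (detDelta L e dV hdV dW' hdW' p)
  · have hu' : IsUnit (detDelta L e dV hdV dW hdW (θ p)) := by rwa [detDelta_eq_of_coe_eq hθ]
    rw [dif_pos hu', dif_pos hu]
    congr 1
    exact Units.ext (by rw [IsUnit.unit_spec, IsUnit.unit_spec, detDelta_eq_of_coe_eq hθ])
  · have hu' : ¬ IsUnit (detDelta L e dV hdV dW hdW (θ p)) := by rwa [detDelta_eq_of_coe_eq hθ]
    rw [dif_neg hu', dif_neg hu]

/-- `|det_Δ (θ p)|^{1/2} = |det_Δ p|^{1/2}`. [cite: GelbartRogawski1991, §3.1 Prop. 3.1.1 p. 455 L1–2] -/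
theorem modDelta_eq_of_coe_eq
    (hθ : ∀ h : HA L e dV hdV dW' hdW',
      (((θ h : HA L e dV hdV dW hdW) : GL (Fin (n + n)) (AdeleRing (𝓞 L) L)) : Matrix (Fin (n + n)) (Fin (n + n)) (AdeleRing (𝓞 L) L)) =
        (((h : HA L e dV hdV dW' hdW') : GL (Fin (n + n)) (AdeleRing (𝓞 L) L)) : Matrix (Fin (n + n)) (Fin (n + n)) (AdeleRing (𝓞 L) L)))
    (p : HA L e dV hdV dW' hdW') :
    modDelta L e dV hdV dW hdW (θ p) = modDelta L e dV hdV dW' hdW' p := by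
  unfold modDelta
  by_cases hu : IsUnit (detDelta L e dV hdV dW' hdW' p)
  · have hu' : IsUnit (detDelta L e dV hdV dW hdW (θ p)) := by rwa [detDelta_eq_of_coe_eq hθ]
    rw [dif_pos hu', dif_pos hu]
    have e1 : hu'.unit = hu.unit := Units.ext (by rw [IsUnit.unit_spec, IsUnit.unit_spec, detDelta_eq_of_coe_eq hθ])
    rw [e1]
  · have hu' : ¬ IsUnit (detDelta L e dV hdV dW hdW (θ p)) := by rwa [detDelta_eq_of_coe_eq hθ]
    rw [dif_neg hu', dif_neg hu]

/-- **`χ⁻¹(det_Δ p) = conj (χ(det_Δ p))` for UNITARY `χ`** (as complex numbers). [cite: GelbartRogawski1991, §3.1 Prop. 3.1.1 p. 455 L1–2] -/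
theorem coe_chiDet_inv (χ : HeckeCharacter L) (hχu : χ.IsUnitary) (h' : HA L e dV hdV dW' hdW') :
    ((chiDet L e dV hdV dW' hdW' χ⁻¹ h' : ℂˣ) : ℂ) = conj ((chiDet L e dV hdV dW' hdW' χ h' : ℂˣ) : ℂ) := by
  unfold chiDet
  by_cases hu : IsUnit (detDelta L e dV hdV dW' hdW' h')
  · rw [dif_pos hu, dif_pos hu, HeckeCharacter.inv_apply, Units.val_inv_eq_inv_val, Complex.inv_eq_conj (hχu _)]
  · rw [dif_neg hu, dif_neg hu, Units.val_one, map_one]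

/-- the identity-of-matrices map `H_{dW′}(𝔸) = H_{dW}(𝔸)` (★ `HA_eq`) does not move matrices. [cite: Kudla1994, §2] -/
theorem coe_subgroupCongr_HA_eq (hneg : realDiagonal L dW' hdW' = -realDiagonal L dW hdW) (h : HA L e dV hdV dW' hdW') :
    ((((MulEquiv.subgroupCongr (HA_eq (e := e) (dV := dV) (hdV := hdV) hneg)).toMonoidHom h : HA L e dV hdV dW hdW) : GL (Fin (n + n)) (AdeleRing (𝓞 L) L)) :
        Matrix (Fin (n + n)) (Fin (n + n)) (AdeleRing (𝓞 L) L)) =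
      (((h : HA L e dV hdV dW' hdW') : GL (Fin (n + n)) (AdeleRing (𝓞 L) L)) : Matrix (Fin (n + n)) (Fin (n + n)) (AdeleRing (𝓞 L) L)) :=
  congrArg (fun g : GL (Fin (n + n)) (AdeleRing (𝓞 L) L) => (g : Matrix (Fin (n + n)) (Fin (n + n)) (AdeleRing (𝓞 L) L)))
    (MulEquiv.subgroupCongr_apply (HA_eq (e := e) (dV := dV) (hdV := hdV) hneg) h)

/-- … and is continuous (subtype topologies on the same matrices). [cite: Kudla1994, §2] -/
theorem continuous_subgroupCongr_HA_eq (hneg : realDiagonal L dW' hdW' = -realDiagonal L dW hdW) :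
    Continuous ((MulEquiv.subgroupCongr (HA_eq (e := e) (dV := dV) (hdV := hdV) hneg)).toMonoidHom :
      HA L e dV hdV dW' hdW' →* HA L e dV hdV dW hdW) :=
  continuous_induced_rng.2 (by
    have h : (fun g : HA L e dV hdV dW' hdW' =>
        (((MulEquiv.subgroupCongr (HA_eq (e := e) (dV := dV) (hdV := hdV) hneg)).toMonoidHom g : HA L e dV hdV dW hdW) : GL (Fin (n + n)) (AdeleRing (𝓞 L) L))) =
        fun g : HA L e dV hdV dW' hdW' => (g : GL (Fin (n + n)) (AdeleRing (𝓞 L) L)) :=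
      funext fun g => MulEquiv.subgroupCongr_apply (HA_eq (e := e) (dV := dV) (hdV := hdV) hneg) g
    rw [Function.comp_def, h]
    exact continuous_subtype_val)

end Siegel

/-! ## §4 The mirror lies over `ι^𝔻` -/

section Proj

variable {L e dV hdV dW hdW dW' hdW'}
variable {θ : HA L e dV hdV dW' hdW' →* HA L e dV hdV dW hdW}

/-- `ι^𝔻_{dW}(θ h) = ι^𝔻_{dW′}(h)` as automorphisms of `𝕎^𝔻_𝔸` for a matrix-preserving `θ` (★ `toSpD_apply_reIm`). [cite: GelbartRogawski1991, §3.1 p. 454] -/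
theorem coe_toSpD_eq_of_coe_eq
    (hθ : ∀ h : HA L e dV hdV dW' hdW',
      (((θ h : HA L e dV hdV dW hdW) : GL (Fin (n + n)) (AdeleRing (𝓞 L) L)) : Matrix (Fin (n + n)) (Fin (n + n)) (AdeleRing (𝓞 L) L)) =
        (((h : HA L e dV hdV dW' hdW') : GL (Fin (n + n)) (AdeleRing (𝓞 L) L)) : Matrix (Fin (n + n)) (Fin (n + n)) (AdeleRing (𝓞 L) L)))
    (h' : HA L e dV hdV dW' hdW') :
    ((toSpD L e dV hdV dW hdW (θ h') : symplecticGroup (polar (adelicForm (Fp L) (Fin (n + n)) (gramDA L e dV hdV dW hdW)))) :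
        ((Fin (n + n) → AdeleRing (𝓞 (Fp L)) (Fp L)) × (Fin (n + n) → AdeleRing (𝓞 (Fp L)) (Fp L))) ≃ₗ[AdeleRing (𝓞 (Fp L)) (Fp L)]
          ((Fin (n + n) → AdeleRing (𝓞 (Fp L)) (Fp L)) × (Fin (n + n) → AdeleRing (𝓞 (Fp L)) (Fp L)))) =
      (toSpD L e dV hdV dW' hdW' h' : symplecticGroup (polar (adelicForm (Fp L) (Fin (n + n)) (gramDA L e dV hdV dW' hdW')))) := by
  refine LinearEquiv.ext fun w => ?_
  -- every vector of `𝕎^𝔻_𝔸` is `reIm x`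
  obtain ⟨x, rfl⟩ : ∃ x : Fin (n + n) → AdeleRing (𝓞 L) L,
      QuadraticCoordinates.reIm (quadraticAdeleEquiv (Fp L) L (IsCMField.complexConj L) (complexConj_imagUnit L) (imagUnit_ne_zero L)).toAddEquiv
        (Fin (n + n)) x = w :=
    ⟨(QuadraticCoordinates.reIm (quadraticAdeleEquiv (Fp L) L (IsCMField.complexConj L) (complexConj_imagUnit L) (imagUnit_ne_zero L)).toAddEquiv
        (Fin (n + n))).symm w, by rw [AddEquiv.apply_symm_apply]⟩
  rw [toSpD_apply_reIm, toSpD_apply_reIm, hθ h']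

set_option maxHeartbeats 4000000 in
/-- **`π′ ∘ sD′ = ι′^𝔻`** for the mirror `sD′ := mpCongr ∘ (·)ᶜ ∘ sD ∘ θ` of a homomorphism `sD` over `ι^𝔻` along a matrix-preserving `θ`: complex
conjugation and the re-typing do not move symplectic components (★ `coe_proj_adelicMpContConj`, ★ `coe_proj_mpCongr`), and `ι^𝔻_{dW}(θ h) = ι^𝔻_{dW′}(h)`.
[cite: GelbartRogawski1991, §3.1 p. 454] [cite: MoeglinVignerasWaldspurger1987, Chap. 2 II.1 (B)] -/
theorem proj_mirror (hneg : realDiagonal L dW' hdW' = -realDiagonal L dW hdW)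
    (hθ : ∀ h : HA L e dV hdV dW' hdW',
      (((θ h : HA L e dV hdV dW hdW) : GL (Fin (n + n)) (AdeleRing (𝓞 L) L)) : Matrix (Fin (n + n)) (Fin (n + n)) (AdeleRing (𝓞 L) L)) =
        (((h : HA L e dV hdV dW' hdW') : GL (Fin (n + n)) (AdeleRing (𝓞 L) L)) : Matrix (Fin (n + n)) (Fin (n + n)) (AdeleRing (𝓞 L) L)))
    {sD : HA L e dV hdV dW hdW →* MpD L e dV hdV dW hdW} (hproj : ∀ h, projD L e dV hdV dW hdW (sD h) = toSpD L e dV hdV dW hdW h)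
    (h' : HA L e dV hdV dW' hdW') :
    projD L e dV hdV dW' hdW'
        ((((mpCongr (gramDA_eq_neg (e := e) (dV := dV) (hdV := hdV) hneg).symm).toMonoidHom.comp
            ((adelicMpContConj (Fp L) (Fin (n + n)) (gramDA L e dV hdV dW hdW)).toMonoidHom.comp sD)).comp θ) h') =
      toSpD L e dV hdV dW' hdW' h' := by
  -- `((mpCongr ∘ conj ∘ sD) ∘ θ) h′` is DEFINITIONALLY `mpCongr ((sD (θ h′))ᶜ)`; no `rw`
  have e1 : ((projD L e dV hdV dW' hdW'
      ((mpCongr (gramDA_eq_neg (e := e) (dV := dV) (hdV := hdV) hneg).symm)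
        (adelicMpContConj (Fp L) (Fin (n + n)) (gramDA L e dV hdV dW hdW) (sD (θ h')))) :
        symplecticGroup (polar (adelicForm (Fp L) (Fin (n + n)) (gramDA L e dV hdV dW' hdW')))) :
        ((Fin (n + n) → AdeleRing (𝓞 (Fp L)) (Fp L)) × (Fin (n + n) → AdeleRing (𝓞 (Fp L)) (Fp L))) ≃ₗ[AdeleRing (𝓞 (Fp L)) (Fp L)]
          ((Fin (n + n) → AdeleRing (𝓞 (Fp L)) (Fp L)) × (Fin (n + n) → AdeleRing (𝓞 (Fp L)) (Fp L)))) =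
      (projD L e dV hdV dW hdW (sD (θ h')) : symplecticGroup (polar (adelicForm (Fp L) (Fin (n + n)) (gramDA L e dV hdV dW hdW)))) :=
    (adelicMpCont.coe_proj_mpCongr (gramDA_eq_neg (e := e) (dV := dV) (hdV := hdV) hneg).symm
        (adelicMpContConj (Fp L) (Fin (n + n)) (gramDA L e dV hdV dW hdW) (sD (θ h')))).trans
      (coe_proj_adelicMpContConj (sD (θ h')))
  have e2 := congrArg (fun q : symplecticGroup (polar (adelicForm (Fp L) (Fin (n + n)) (gramDA L e dV hdV dW hdW))) =>
      (q : ((Fin (n + n) → AdeleRing (𝓞 (Fp L)) (Fp L)) × (Fin (n + n) → AdeleRing (𝓞 (Fp L)) (Fp L))) ≃ₗ[AdeleRing (𝓞 (Fp L)) (Fp L)]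
        ((Fin (n + n) → AdeleRing (𝓞 (Fp L)) (Fp L)) × (Fin (n + n) → AdeleRing (𝓞 (Fp L)) (Fp L))))) (hproj (θ h'))
  exact Subtype.ext (e1.trans (e2.trans (coe_toSpD_eq_of_coe_eq hθ h')))

end Proj

end Summit.HodgeConjecture.HodgeConjecture.Cruxes.HLiu418.DoubledWeilMirror

end
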